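import Summits.QuantumFields.YangMills.Theorems.BalabanUVNodesN11Thm2PointCountAtRecord13CoPH
import Literature.MathematicalPhysics.QuantumFieldTheory.Balaban1983to89.Node00.AveragingSkewPresentation

/-!
# DAG node N11 — THE SATURATION HYPOTHESIS `hY` AT def-R's REGIONS OF RECORD IS A THEOREM: every `Ω_i(s)` of a (2.18) history of record is an
# `n`-block union (`n ≤ i`), so the two-block window (g20 `Node00.AveragingTwoBlockWindow`) and the skew presentation of the averaging of record
# (g21 `Node00.AveragingSkewPresentation`) hold at 11a's generation data `sV = bondsIn j (Ω_{j+1})ᶜ`, `sV' = bondsIn (j+1) (Ω_{j+1})ᶜ` with NO displayed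
# geometric hypothesis

Cell `pub-ymgap`, YM-PLAN Track A (D-0062), seat `pub-ymgap-dag-n11-e` (g21; R134 N11 [B14] s3), route `BalabanUVNodes`, key item K1⁷ `StabilityBAtRecordR13SepCoPH` =
stmt-QuantumFields-20542 (helper, count-neutral).  CONSUMED BY NAME, nothing modified: dag-n11-w2's `…N11Thm2PointCountAtRecord13CoPH` §1b
(`isBlockUnion_of_mem_unionsOfCubes`, `isBlockUnion_empty`: a member of `unionsOfCubes P s` with `Lⁿ ∣ s` is an `n`-block union), def-R's `Node00.LargeFieldReprOfRecord`
(`SeqOfRecord`, `DOfRecord`, `dCubeSide`; r11's `Seq.chain.memΩ` ∕ `Seq.Ω_off`), def-T's 11a `Node00.TkOfRecord` (`genDataOfRecord`, `avgRestrOfRecord`), g20's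
`Node00.AveragingTwoBlockWindow` (`toFine_mem_iff_of_isBlockUnion_level`, `avgRestrOfRecord_genData_apply_eq_avOfRecord_of_isBlockUnion_level`) and g21's
`Node00.AveragingSkewPresentation` (§3 faces at `(bondsIn j Y).toFinset`).  [III] = [Balaban1988Convergent].

WHY.  Both Node00 files display the saturation `hY : ∀ x, toFine j x ∈ Y ↔ toFine (j+1) (blockOf x) ∈ Y` of the fine region `Y = (Ω_{j+1})ᶜ` (or an `IsBlockUnion`
fact giving it).  At def-R's regions of record it is TRUE: `Ω_{j+1}(s) ∈ 𝐃_{j+1}` = unions of cubes of side `L^{j+1}·M·R_{j+1}` ((2.1) p. 254), a multiple of `L^{j+1}`, hence a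
`(j+1)`-block union (dag-n11-w2's §1b, a Summits theorem — which is why this discharge lives under `Theorems/` and not in the Literature files).  So the
consumers of the separated transport at the record (dag-n11-w2 CLAIM-3 `…N11TransportOfRecordSeparated`, dag-n11-d `…SkewInnerChart`, dag-n08-w2
`…TStepInFibreChart`, def-T's (†)) read the five record inputs with only the standing-range inequality `j + 1 ≤ m + K` displayed.

WHAT THIS FILE PROVES (theorems only; 0 `def`, 0 `sorry`).
§1 `isBlockUnion_Omega_seqOfRecord` (`Ω_i(s)` is an `n`-block union for `n ≤ i`, `n ≤ m + K`) · `isBlockUnion_compl_Omega_seqOfRecord` · `isBlockUnion_pow_iff_level` (the two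
   block-union currencies of the tree agree in the standing range) · `isBlockUnionPow_Omega_seqOfRecord` (the `B10Eq38TorusDomains` currency) · ★ `toFine_mem_compl_Omega_iff`
   (THE `hY` OF RECORD: `toFine j x ∈ (Ω_{j+1}(s))ᶜ ↔ toFine (j+1) (blockOf x) ∈ (Ω_{j+1}(s))ᶜ`) · `toFine_mem_Omega_iff`.
§2 hypothesis-free record faces: `avOfRecord_congr_of_eqOn_bondsIn_Omega` (the two-block window at the record) · ★ `avgRestrOfRecord_genData_apply_eq_avOfRecord` at the record (11a's restricted averaging of `genDataOfRecord … s S j` IS the true average on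
   its image bonds, every completion) · ★★ `avOfRecord_glue_eq_glue_Omega` (the skew intertwining at `sV = (bondsIn j (Ω_{j+1})ᶜ).toFinset`, `sV' = (bondsIn (j+1) (Ω_{j+1})ᶜ).toFinset`)
   · ★★ `map_pi_avgRestrOfRecord_absolutelyContinuous_Omega` (`hac_out`) + its 11a-keyed reading `map_pi_avgRestrOfRecord_genData_absolutelyContinuous` («`kernelRTOfRecord` at the
   generation data of record IS a renormalization transformation of the V-bond variables») · ★★ `map_prod_avOfRecord_glue_skew_absolutelyContinuous_Omega` (`hac_in`).

HONEST FRAMING.  Lattice bookkeeping + composition by name; nothing of Bałaban's estimates asserted; the separated-transport identity itself is the consumers'; (B4)∕(S-α) NOT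
closed; N11 NOT discharged; K1⁷ NOT closed; counts unmoved (typed 28∕28 · discharged 5∕27).  One finite `𝕋⁴` programme at fixed `ε = L^{−K}`; R4 closes only the conditional
finite-𝕋⁴ rung `BalabanLadder.UV`; NOT ℝ⁴ ∕ OS ∕ mass gap ∕ Clay.  Sources (locators only): [III] (2.1) p. 254, (2.21) p. 258, (3.1) p. 264; [Balaban1987RG1] (0.1) p. 251, (0.4) p. 253.
-/

noncomputable section

namespace Summit.QuantumFields.YangMills.Theorems.BalabanUVNodesN11AveragingSkewPresentationAtRecord

open _root_.MeasureTheory _root_.Function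
open Literature.MathematicalPhysics.QuantumFieldTheory.Balaban1983to89
open T4Continuum BlockAveraging
open B14.Eq22Determines (IsBlockUnion)
open B10Eq38TorusDomains (toFine)
open B10Eq42TorusConstraint (bondsIn mem_bondsIn_iff)
open Summit.QuantumFields.YangMills.Theorems.BalabanUVNodesN11Thm2PointCountAtRecord13CoPH (isBlockUnion_of_mem_unionsOfCubes isBlockUnion_empty)
open Node00 hiding blockIter

/-! ## §1  The regions of record are block unions; the saturation `hY` of record -/

section Regions

variable {F : T4Family} {ν : Stage7Numerics} {M : ℕ} {g : ℕ → ℝ} {K k : ℕ}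

/-- **`Ω_i(s)` OF A (2.18) HISTORY OF RECORD IS AN `n`-BLOCK UNION** for every `n ≤ i` in the standing range `n ≤ m + K`: inside the window `1 ≤ i ≤ k` it is a member of
`𝐃_i = unionsOfCubes (Lⁱ·M·R_i)` ((2.1), `Seq.chain.memΩ`) and `Lⁿ ∣ Lⁱ·M·R_i`; off the window it is `∅` (`Seq.Ω_off`). [cite: Balaban1988Convergent, (2.1) p.254] -/
theorem isBlockUnion_Omega_seqOfRecord (s : SeqOfRecord F ν M g K k) {i n : ℕ} (hn : n ≤ (F.P K).m + (F.P K).K) (hni : n ≤ i) :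
    IsBlockUnion n (s.Ω i) := by
  by_cases hi : 1 ≤ i ∧ i ≤ k
  · have hmem : s.Ω i ∈ DOfRecord F ν M g K i := s.chain.memΩ i hi.1 hi.2
    refine isBlockUnion_of_mem_unionsOfCubes hn ?_ hmem
    unfold dCubeSide
    exact Dvd.dvd.mul_right (Dvd.dvd.mul_right (pow_dvd_pow _ hni) _) _
  · rw [s.Ω_off i hi]
    exact isBlockUnion_empty n

/-- … hence so is its complement `(Ω_i(s))ᶜ` (the region of the KEPT conditional `V`-integrations of (2.21) at `i = j+1`). [cite: Balaban1988Convergent, (2.1) p.254, (2.21) p.258] -/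
theorem isBlockUnion_compl_Omega_seqOfRecord (s : SeqOfRecord F ν M g K k) {i n : ℕ} (hn : n ≤ (F.P K).m + (F.P K).K) (hni : n ≤ i) :
    IsBlockUnion n (s.Ω i)ᶜ := fun x => by
  simp only [Set.mem_compl_iff]
  exact not_congr (isBlockUnion_Omega_seqOfRecord s hn hni x)

/-- **THE TWO BLOCK-UNION CURRENCIES OF THE TREE AGREE** in the standing range `j ≤ m + K`: «`X` is a union of `Lʲ`-cubes» (`B10Eq38TorusDomains.IsBlockUnion (L^j)`, the currency
of `B10Eq68TorusRegularity`) iff «`X` is a union of `j`-blocks» (`B14.Eq22Determines.IsBlockUnion j`, the currency of the [15] determining-set files) — the `Lʲ`-cube of a fine site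
is read off its `j`-block (`B10Eq71TorusOverlap.blockIter_eq_iff_cubeIdx`). [cite: Balaban1987RG1, (0.1) p.251; Balaban1988Convergent, (2.1) p.254] -/
theorem isBlockUnion_pow_iff_level {P : Params} {j : ℕ} (hj : j ≤ P.m + P.K) (X : Set (Site P 0)) :
    B10Eq38TorusDomains.IsBlockUnion (P.L ^ j) X ↔ IsBlockUnion j X := by
  have hrep : ∀ x : Site P 0, B3Ineq314Cubes.cubeIdx (P.L ^ j) x =
      B3Ineq314Cubes.cubeIdx (P.L ^ j) (B15DeterminingSets.embIter j (B14.Eq22Determines.blockIter j x)) := fun x => by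
    rw [← B10Eq71TorusOverlap.toFine_eq_embIter]
    exact (B10Eq71TorusOverlap.blockIter_eq_iff_cubeIdx hj x _).1 rfl
  constructor
  · intro h x
    exact h (hrep x)
  · intro h x y hxy
    have hb : B14.Eq22Determines.blockIter j x = B14.Eq22Determines.blockIter j y :=
      (B10Eq71TorusOverlap.blockIter_eq_iff_cubeIdx hj x _).2
        (hxy.trans ((B10Eq71TorusOverlap.blockIter_eq_iff_cubeIdx hj y _).1 rfl))
    rw [h x, h y, hb]

/-- `Ω_i(s)` of a history of record is a union of `Lⁿ`-cubes (`B10Eq38TorusDomains` currency), `n ≤ i`, `n ≤ m + K`. [cite: Balaban1988Convergent, (2.1) p.254] -/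
theorem isBlockUnionPow_Omega_seqOfRecord (s : SeqOfRecord F ν M g K k) {i n : ℕ} (hn : n ≤ (F.P K).m + (F.P K).K) (hni : n ≤ i) :
    B10Eq38TorusDomains.IsBlockUnion ((F.P K).L ^ n) (s.Ω i) :=
  (isBlockUnion_pow_iff_level hn _).2 (isBlockUnion_Omega_seqOfRecord s hn hni)

/-- **★ THE SATURATION `hY` OF RECORD** (the displayed hypothesis of `Node00.AveragingTwoBlockWindow` ∕ `Node00.AveragingSkewPresentation` at `Y = (Ω_{j+1}(s))ᶜ`, now a theorem):
a level-`j` site lies in `(Ω_{j+1}(s))ᶜ` iff its `(j+1)`-block does. [cite: Balaban1988Convergent, (2.1) p.254; Balaban1987RG1, (0.1) p.251] -/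
theorem toFine_mem_compl_Omega_iff (s : SeqOfRecord F ν M g K k) {j : ℕ} (hj : j + 1 ≤ (F.P K).m + (F.P K).K) (x : Site (F.P K) j) :
    toFine j x ∈ (s.Ω (j + 1))ᶜ ↔ toFine (j + 1) (blockOf x) ∈ (s.Ω (j + 1))ᶜ :=
  toFine_mem_iff_of_isBlockUnion_level hj (isBlockUnion_compl_Omega_seqOfRecord s hj le_rfl) x

/-- The same for `Ω_{j+1}(s)` itself. [cite: Balaban1988Convergent, (2.1) p.254; Balaban1987RG1, (0.1) p.251] -/
theorem toFine_mem_Omega_iff (s : SeqOfRecord F ν M g K k) {j : ℕ} (hj : j + 1 ≤ (F.P K).m + (F.P K).K) (x : Site (F.P K) j) :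
    toFine j x ∈ s.Ω (j + 1) ↔ toFine (j + 1) (blockOf x) ∈ s.Ω (j + 1) :=
  toFine_mem_iff_of_isBlockUnion_level hj (isBlockUnion_Omega_seqOfRecord s hj le_rfl) x

end Regions

/-! ## §2  The two-block window and the skew presentation at the bond sets of record, hypothesis-free -/

section Faces

variable (F : T4Family) (N : ℕ) [NeZero N]

/-- **THE TWO-BLOCK WINDOW AT THE RECORD** (g20's `avOfRecord_congr_of_eqOn_bondsIn` with `hY` discharged): two level-`j` fields agreeing on the bonds of `(Ω_{j+1}(s))ᶜ` have the
same average of record at every level-`(j+1)` bond of `(Ω_{j+1}(s))ᶜ` — the KEPT conditional `V`-integrations of (2.21) read no variable on or across `Ω_{j+1}`.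
[cite: Balaban1988Convergent, (2.21) p.258; Balaban1987RG1, (0.4) p.253] -/
theorem avOfRecord_congr_of_eqOn_bondsIn_Omega {ν : Stage7Numerics} {M : ℕ} {g : ℕ → ℝ} (K : ℕ) {k : ℕ} (s : SeqOfRecord F ν M g K k) (j : ℕ)
    (hj : j + 1 ≤ (F.P K).m + (F.P K).K) {U U' : GaugeField (F.P K) j (SU N)}
    (hUU' : ∀ b : PBond (F.P K) j, b ∈ bondsIn j (s.Ω (j + 1))ᶜ → U b = U' b)
    {c : PBond (F.P K) (j + 1)} (hc : c ∈ bondsIn (j + 1) (s.Ω (j + 1))ᶜ) :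
    (avOfRecord F N K j).avg U c = (avOfRecord F N K j).avg U' c :=
  avOfRecord_congr_of_eqOn_bondsIn F N K j hj (toFine_mem_compl_Omega_iff s hj) hUU' hc

/-- **★ AT THE RECORD, 11a's RESTRICTED AVERAGING OF `genDataOfRecord` IS THE TRUE AVERAGE ON ITS IMAGE BONDS** — g20's
`avgRestrOfRecord_genData_apply_eq_avOfRecord_of_isBlockUnion_level` with the block-union hypothesis DISCHARGED by §1: for every history `s`, branch `S`, weights `W`, level `j`
with `j + 1 ≤ m + K`, every field `U` and every image bond `c'`. [cite: Balaban1988Convergent, (2.21) p.258, (3.1) p.264] -/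
theorem avgRestrOfRecord_genData_apply_eq_avOfRecord {V : Type} (ν : Stage7Numerics) (M : ℕ) (g : ℕ → ℝ) (K : ℕ) (W : TkWeights F N V K) {k : ℕ}
    (s : SeqOfRecord F ν M g K k) (S : ℕ → Set (Site (F.P K) 0)) (j : ℕ) [DecidableEq (PBond (F.P K) j)] (hj : j + 1 ≤ (F.P K).m + (F.P K).K)
    (U : GaugeField (F.P K) j (SU N)) (c' : ↥(genDataOfRecord F N V ν M g K W s S j).sV') :
    avgRestrOfRecord F N K j (genDataOfRecord F N V ν M g K W s S j).sV (genDataOfRecord F N V ν M g K W s S j).sV' (fun b => U b) c' =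
      (avOfRecord F N K j).avg U c' :=
  avgRestrOfRecord_genData_apply_eq_avOfRecord_of_isBlockUnion_level F N ν M g K W s S j hj (isBlockUnion_Omega_seqOfRecord s hj le_rfl) U c'

/-- **★★ THE SKEW INTERTWINING AT THE BOND SETS OF RECORD**, hypothesis-free: at `sV := (bondsIn j (Ω_{j+1}(s))ᶜ).toFinset`, `sV' := (bondsIn (j+1) (Ω_{j+1}(s))ᶜ).toFinset` (11a's
`genDataOfRecord … s S j` V-bonds and image bonds), gluing a datum and averaging = gluing the restricted averaging of the `sV`-part with the remaining coarse variables.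
[cite: Balaban1988Convergent, (2.21) p.258, (3.1) p.264] -/
theorem avOfRecord_glue_eq_glue_Omega {ν : Stage7Numerics} {M : ℕ} {g : ℕ → ℝ} (K : ℕ) {k : ℕ} (s : SeqOfRecord F ν M g K k) (j : ℕ)
    [DecidableEq (PBond (F.P K) j)] [DecidableEq (PBond (F.P K) (j + 1))] (hj : j + 1 ≤ (F.P K).m + (F.P K).K)
    (q : (↥(Set.toFinite (bondsIn j (s.Ω (j + 1))ᶜ)).toFinset → SU N) ×
      ({b : PBond (F.P K) j // b ∉ (Set.toFinite (bondsIn j (s.Ω (j + 1))ᶜ)).toFinset} → SU N)) :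
    (avOfRecord F N K j).avg
        ((MeasurableEquiv.piEquivPiSubtypeProd (fun _ : PBond (F.P K) j => SU N)
          (· ∈ (Set.toFinite (bondsIn j (s.Ω (j + 1))ᶜ)).toFinset)).symm q) =
      (MeasurableEquiv.piEquivPiSubtypeProd (fun _ : PBond (F.P K) (j + 1) => SU N)
          (· ∈ (Set.toFinite (bondsIn (j + 1) (s.Ω (j + 1))ᶜ)).toFinset)).symm
        (avgRestrOfRecord F N K j (Set.toFinite (bondsIn j (s.Ω (j + 1))ᶜ)).toFinset
            (Set.toFinite (bondsIn (j + 1) (s.Ω (j + 1))ᶜ)).toFinset q.1,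
          fun c : {c : PBond (F.P K) (j + 1) // c ∉ (Set.toFinite (bondsIn (j + 1) (s.Ω (j + 1))ᶜ)).toFinset} =>
            (avOfRecord F N K j).avg
              ((MeasurableEquiv.piEquivPiSubtypeProd (fun _ : PBond (F.P K) j => SU N)
                (· ∈ (Set.toFinite (bondsIn j (s.Ω (j + 1))ᶜ)).toFinset)).symm q) c) :=
  avOfRecord_glue_eq_glue_bondsIn F N K j hj (toFine_mem_compl_Omega_iff s hj) q

/-- **★★ `hac_out` AT THE BOND SETS OF RECORD**, hypothesis-free: 11a's restricted averaging of the V-bonds `bondsIn j (Ω_{j+1}(s))ᶜ` onto the image bonds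
`bondsIn (j+1) (Ω_{j+1}(s))ᶜ` pushes product Haar measure to an absolutely continuous law. [cite: Balaban1988Convergent, (2.21) p.258] -/
theorem map_pi_avgRestrOfRecord_absolutelyContinuous_Omega {ν : Stage7Numerics} {M : ℕ} {g : ℕ → ℝ} (K : ℕ) {k : ℕ} (s : SeqOfRecord F ν M g K k) (j : ℕ)
    [DecidableEq (PBond (F.P K) j)] [DecidableEq (PBond (F.P K) (j + 1))] (hj : j + 1 ≤ (F.P K).m + (F.P K).K) :
    (Measure.pi fun _ : ↥(Set.toFinite (bondsIn j (s.Ω (j + 1))ᶜ)).toFinset => (HaarData.haar : Measure (SU N))).map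
        (avgRestrOfRecord F N K j (Set.toFinite (bondsIn j (s.Ω (j + 1))ᶜ)).toFinset (Set.toFinite (bondsIn (j + 1) (s.Ω (j + 1))ᶜ)).toFinset) ≪
      Measure.pi fun _ : ↥(Set.toFinite (bondsIn (j + 1) (s.Ω (j + 1))ᶜ)).toFinset => (HaarData.haar : Measure (SU N)) :=
  map_pi_avgRestrOfRecord_absolutelyContinuous_bondsIn F N K j hj (toFine_mem_compl_Omega_iff s hj)

/-- The same keyed by 11a's `genDataOfRecord … s S j` (its V-bond and image-bond sets are these finsets): «THE RESTRICTED TRANSPORT OF RECORD `kernelRTOfRecord` AT THE GENERATION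
DATA OF RECORD IS A RENORMALIZATION TRANSFORMATION of the V-bond variables» (Haar absolute continuity of its averaging). [cite: Balaban1988Convergent, (2.21) p.258] -/
theorem map_pi_avgRestrOfRecord_genData_absolutelyContinuous {V : Type} (ν : Stage7Numerics) (M : ℕ) (g : ℕ → ℝ) (K : ℕ) (W : TkWeights F N V K) {k : ℕ}
    (s : SeqOfRecord F ν M g K k) (S : ℕ → Set (Site (F.P K) 0)) (j : ℕ) [DecidableEq (PBond (F.P K) j)] [DecidableEq (PBond (F.P K) (j + 1))]
    (hj : j + 1 ≤ (F.P K).m + (F.P K).K) :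
    (Measure.pi fun _ : ↥(genDataOfRecord F N V ν M g K W s S j).sV => (HaarData.haar : Measure (SU N))).map
        (avgRestrOfRecord F N K j (genDataOfRecord F N V ν M g K W s S j).sV (genDataOfRecord F N V ν M g K W s S j).sV') ≪
      Measure.pi fun _ : ↥(genDataOfRecord F N V ν M g K W s S j).sV' => (HaarData.haar : Measure (SU N)) :=
  map_pi_avgRestrOfRecord_absolutelyContinuous_Omega F N K s j hj

/-- **★★ `hac_in` AT THE BOND SETS OF RECORD**, hypothesis-free: the skew map `(y, r) ↦ (y, c ↦ avg (glue (y, r)) c)` (`c` off the image bonds) pushes product Haar measure to an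
absolutely continuous law. [cite: Balaban1988Convergent, (2.21) p.258, (3.1) p.264] -/
theorem map_prod_avOfRecord_glue_skew_absolutelyContinuous_Omega {ν : Stage7Numerics} {M : ℕ} {g : ℕ → ℝ} (K : ℕ) {k : ℕ} (s : SeqOfRecord F ν M g K k)
    (j : ℕ) [DecidableEq (PBond (F.P K) j)] [DecidableEq (PBond (F.P K) (j + 1))] (hj : j + 1 ≤ (F.P K).m + (F.P K).K) :
    ((Measure.pi fun _ : ↥(Set.toFinite (bondsIn j (s.Ω (j + 1))ᶜ)).toFinset => (HaarData.haar : Measure (SU N))).prod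
        (Measure.pi fun _ : {b : PBond (F.P K) j // b ∉ (Set.toFinite (bondsIn j (s.Ω (j + 1))ᶜ)).toFinset} =>
          (HaarData.haar : Measure (SU N)))).map
        (fun q => (q.1, fun c : {c : PBond (F.P K) (j + 1) // c ∉ (Set.toFinite (bondsIn (j + 1) (s.Ω (j + 1))ᶜ)).toFinset} =>
          (avOfRecord F N K j).avg
            ((MeasurableEquiv.piEquivPiSubtypeProd (fun _ : PBond (F.P K) j => SU N)
              (· ∈ (Set.toFinite (bondsIn j (s.Ω (j + 1))ᶜ)).toFinset)).symm q) c)) ≪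
      (Measure.pi fun _ : ↥(Set.toFinite (bondsIn j (s.Ω (j + 1))ᶜ)).toFinset => (HaarData.haar : Measure (SU N))).prod
        (Measure.pi fun _ : {c : PBond (F.P K) (j + 1) // c ∉ (Set.toFinite (bondsIn (j + 1) (s.Ω (j + 1))ᶜ)).toFinset} =>
          (HaarData.haar : Measure (SU N))) :=
  map_prod_avOfRecord_glue_skew_absolutelyContinuous_bondsIn F N K j hj (toFine_mem_compl_Omega_iff s hj)

end Faces

end Summit.QuantumFields.YangMills.Theorems.BalabanUVNodesN11AveragingSkewPresentationAtRecord

end
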